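import Summits.BirchSwinnertonDyer.BirchSwinnertonDyer.Theorems.ShaPrimaryTransferFiniteShaComponentTransferOddDoorIsogenyDescent
import Literature.NumberTheory.EllipticCurves.Curve2000HiddenClassCount
import Literature.NumberTheory.EllipticCurves.BSDInvariantsProofs
import HarnessLib

/-!
# BirchSwinnertonDyer / ShaPrimaryTransfer — crux `FiniteShaComponentTransfer` (stmt-BirchSwinnertonDyer-22356):
# THE ODD DOOR DECIDES WHERE DESCENT CANNOT — a `2`-torsion class of `Ш` hidden from the isogeny descent
# (`W = [0, 460, 0, 62500, 0]`: descent brackets `2 ≤ #Ш(W/ℚ)[2] ≤ 4`; Cassels–Tate parity gives `4`)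

Sixth helper file of prover seat `bsd-line-spt-p1` g13 (`--supports stmt-22356 --as helper`; namespace `…ShaPrimaryTransferOddDoor`).
THEOREMS ONLY; no definition, no named fact, no `sorry`. BSD is NOT proved by any of this; T is unchanged.

Setting (`Literature/…/Curve2000{SharpDescent, IsogenyChain, SelmerCertificates, HiddenClassCount}`, this seat): the sharp
curve `E₀ = x(x+50)(x−40)` (rank `0`, `Ш(E₀)[2] = 0`) and, TWO `2`-isogeny steps away, the rank-`0` curve
`V₀ = [0, 115, 0, 15625/4, 0] ≅ W = [0, 460, 0, 62500, 0]` with `t_2(V₀) = 0` (through the class) and `φ : V₀ → M₁₀ = [0,−230,0,−2400,0]`.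
Its `2`-isogeny descent gives `L = #Ш(V₀)[φ] = #(Ш(V₀) ∩ im Ξ_{V₀}) = 2` (an ODD power of `2`) and `L' = #(Ш(M₁₀) ∩ im Ξ_{M₁₀}) ∈ {1, 2}`
— so descent alone only brackets `2 ≤ #Ш(V₀/ℚ)[2] ≤ 4`. This is the first curve in the tree where the bracket is NOT closed by descent
(the earlier exact `#Ш[2]` in the tree — `X₈`, `X₃₄₆`, `E₁₇` (`TwoIsogenyShaTwoTorsionExamples`), `X₃₈₈` (`Curve388ShaTwoTorsion`), `…OddDoorCurve346` — all had a sharp dual side `L' = 1`, tree search 2026-08-29). Here: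

* §1 `natCard_sha_torsionBy_two_V₀` — **`#Ш(V₀/ℚ)[2] = 4`** by Cassels–Tate parity (`…OddDoorIsogenyDescent.natCard_sha_torsionBy_two_eq_two_mul_of_odd`:
  `#Ш[2] = 4^m` with `t_2 = 0`, and the only power of `4` in `[2, 4]` is `4`); `natCard_sha_torsionBy_two_W` — the same for the integral
  model `W` (`Ш` is a model invariant).
* §2 `exists_hidden_class_V₀` — **a class of order `2` in `Ш(V₀/ℚ)` NOT in `im Ξ_{V₀}`**: the `2`-isogeny descent through `φ` sees
  `Ш(V₀)[φ] ≅ ℤ/2` only; `Ш(V₀/ℚ)[2]` has `4` elements.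
* §3 `natCard_sha_inf_range_M10_eq_two` — **parity propagates**: `L' = 2`, i.e. `Ш(M₁₀/ℚ)[φ_{M₁₀}] ≅ ℤ/2`
  (`…two_le_natCard_dual_of_shaCorank_two_eq_zero_of_odd`), although NO local point was ever exhibited on the corresponding homogeneous
  space; consequently `twoIsogenySelmerRank'_M10_eq_one` and **`mem_twoIsogenySelmerGroup_W_ten`: the class `10` lies in `S(460, 62500)`** —
  an everywhere-local-solubility statement PROVED BY GLOBAL DUALITY (Cassels–Tate), not by local points.
* §4 reading for T: `t_2 = 0` with square defect `4` on a curve whose own descent cannot show either — the odd door's constructive face.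

References: [Cassels1962ArithmeticIV] Thm. 1.1; [SilvermanAEC2009] Thm. X.4.2(a), Prop. X.4.9, X.4.14; [Dokchitser2013ParityNotes] §2;
[SilvermanTate2015] §3.6.
-/

-- D-0017: single-problem summit, so `Summit.BirchSwinnertonDyer.BirchSwinnertonDyer.…` repeats a namespace BY DESIGN.
set_option linter.dupNamespace false
set_option autoImplicit false

noncomputable section

open scoped Classical
open scoped AddSubgroup
open Literature.NumberTheory.EllipticCurves Literature.NumberTheory.EllipticCurves.Curve2000 WeierstrassCurve
open Literature.Algebra.Module (natCard_torsionBy_addSubgroup)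
open WeierstrassCurve.Affine (SqUnits)

namespace Summit.BirchSwinnertonDyer.BirchSwinnertonDyer.Theorems.ShaPrimaryTransferOddDoor

/-! ## §1 `#Ш(V₀/ℚ)[2] = 4` by parity -/

/-- The dual defect on the literal codomain: `1 ≤ #(Ш(V₀.twoIsogenyCodomain) ∩ im Ξ) ≤ 2`. [cite: SilvermanAEC2009, Thm. X.4.2(a) and Prop. X.4.9] -/
theorem natCard_sha_inf_range_twoIsogenyCodomain_V₀ [hV : (⟨0, 115, 0, 15625 / 4, 0⟩ : WeierstrassCurve ℚ).IsElliptic] :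
    1 ≤ Nat.card ↥((⟨0, 115, 0, 15625 / 4, 0⟩ : WeierstrassCurve ℚ).twoIsogenyCodomain.sha ⊓
        AddMonoidHom.range (G := Additive (SqUnits ℚ))
          (⟨0, 115, 0, 15625 / 4, 0⟩ : WeierstrassCurve ℚ).twoIsogenyCodomain.twoIsogenyTorsorHom) ∧
      Nat.card ↥((⟨0, 115, 0, 15625 / 4, 0⟩ : WeierstrassCurve ℚ).twoIsogenyCodomain.sha ⊓
        AddMonoidHom.range (G := Additive (SqUnits ℚ))
          (⟨0, 115, 0, 15625 / 4, 0⟩ : WeierstrassCurve ℚ).twoIsogenyCodomain.twoIsogenyTorsorHom) ≤ 2 := by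
  haveI := isElliptic_M10
  rw [natCard_sha_inf_range_twoIsogenyTorsorHom_congr twoIsogenyCodomain_V₀]
  exact ⟨natCard_sha_inf_range_M10.1, natCard_sha_inf_range_M10.2.1⟩

/-- **`#Ш(V₀/ℚ)[2] = 4`, decided by Cassels–Tate parity** (descent gives only `2 ≤ · ≤ 4`): `t_2(V₀) = 0`, `#Ш(V₀)[φ] = 2 = 2^1`
(odd exponent), dual defect `≤ 2`, so `…natCard_sha_torsionBy_two_eq_two_mul_of_odd` gives `2^{1+1}`.
[cite: Cassels1962ArithmeticIV, Thm. 1.1] [cite: SilvermanAEC2009, Thm. X.4.14 and Prop. X.4.9] -/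
theorem natCard_sha_torsionBy_two_V₀ : Nat.card ((⟨0, 115, 0, 15625 / 4, 0⟩ : WeierstrassCurve ℚ).sha[(2 : ℤ)]) = 4 := by
  haveI := isElliptic_V₀
  obtain ⟨h1, h2⟩ := natCard_sha_inf_range_twoIsogenyCodomain_V₀
  have h := natCard_sha_torsionBy_two_eq_two_mul_of_odd (⟨0, 115, 0, 15625 / 4, 0⟩ : WeierstrassCurve ℚ) shaCorank_V₀_two
    (d := 1) (by rw [pow_one]; exact natCard_sha_inf_range_V₀) odd_one (h2.trans (by norm_num)) h1
  rw [h]; norm_num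

/-- **`#Ш(W/ℚ)[2] = 4` for the integral model `W = [0, 460, 0, 62500, 0]`** (`⟨2,0,0,0⟩ • W = V₀`; `Ш` and its `2`-torsion are
model invariants, tree `shaEquiv`/`galH1Equiv`). [cite: SilvermanAEC2009, X.§4] -/
theorem natCard_sha_torsionBy_two_W : Nat.card ((⟨0, 460, 0, 62500, 0⟩ : WeierstrassCurve ℚ).sha[(2 : ℤ)]) = 4 := by
  set W : WeierstrassCurve ℚ := ⟨0, 460, 0, 62500, 0⟩ with hW
  set C : VariableChange ℚ := ⟨Units.mk0 (2 : ℚ) (by norm_num), 0, 0, 0⟩ with hC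
  have hCW : C • W = ⟨0, 115, 0, 15625 / 4, 0⟩ := smul_W_eq_V₀
  -- the additive isomorphism `Ш(W) ≃+ Ш(C • W)` and its restriction to the `2`-torsion
  let e : W.sha ≃+ (C • W).sha :=
    { shaEquiv W C with
      map_add' := fun a b ↦ Subtype.ext (map_add (galH1Equiv W C) (a : W.galH1) (b : W.galH1)) }
  have hcard : Nat.card (W.sha[(2 : ℤ)]) = Nat.card ((C • W).sha[(2 : ℤ)]) := by
    refine Nat.card_congr
      { toFun := fun x ↦ ⟨e x.1, by
          have hx := AddSubgroup.torsionBy.nsmul_iff.mp x.2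
          exact AddSubgroup.torsionBy.nsmul_iff.mpr (by rw [← map_nsmul, hx, map_zero])⟩
        invFun := fun y ↦ ⟨e.symm y.1, by
          have hy := AddSubgroup.torsionBy.nsmul_iff.mp y.2
          exact AddSubgroup.torsionBy.nsmul_iff.mpr (by rw [← map_nsmul, hy, map_zero])⟩
        left_inv := fun x ↦ Subtype.ext (e.symm_apply_apply x.1)
        right_inv := fun y ↦ Subtype.ext (e.apply_symm_apply y.1) }
  rw [hcard, hCW]
  exact natCard_sha_torsionBy_two_V₀

/-! ## §2 The hidden class -/

/-- **A `2`-torsion class of `Ш(V₀/ℚ)` invisible to the isogeny descent**: `#(Ш(V₀) ∩ H¹[2]) = 4 > 2 = #(Ш(V₀) ∩ im Ξ_{V₀})`, so some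
`c ∈ Ш(V₀/ℚ)` with `2c = 0` is NOT the class of a homogeneous space `C_d` of `φ` (it maps to the non-trivial element of `Ш(M₁₀)[φ̂]`).
[cite: SilvermanAEC2009, Thm. X.4.2(a) and proof of Prop. X.6.2(c)] [cite: Cassels1962ArithmeticIV, Thm. 1.1] -/
theorem exists_hidden_class_V₀ [hV : (⟨0, 115, 0, 15625 / 4, 0⟩ : WeierstrassCurve ℚ).IsElliptic] :
    ∃ c ∈ (⟨0, 115, 0, 15625 / 4, 0⟩ : WeierstrassCurve ℚ).sha, 2 • c = 0 ∧
      c ∉ AddMonoidHom.range (G := Additive (SqUnits ℚ)) (⟨0, 115, 0, 15625 / 4, 0⟩ : WeierstrassCurve ℚ).twoIsogenyTorsorHom := by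
  by_contra hall
  push Not at hall
  have hle : (⟨0, 115, 0, 15625 / 4, 0⟩ : WeierstrassCurve ℚ).sha ⊓
      AddSubgroup.torsionBy (⟨0, 115, 0, 15625 / 4, 0⟩ : WeierstrassCurve ℚ).galH1 2 ≤
      (⟨0, 115, 0, 15625 / 4, 0⟩ : WeierstrassCurve ℚ).sha ⊓
        AddMonoidHom.range (G := Additive (SqUnits ℚ)) (⟨0, 115, 0, 15625 / 4, 0⟩ : WeierstrassCurve ℚ).twoIsogenyTorsorHom := by
    intro c hc
    rw [AddSubgroup.mem_inf] at hc ⊢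
    exact ⟨hc.1, hall c hc.1 ((AddSubgroup.torsionBy.nsmul_iff (n := 2)).mp hc.2)⟩
  have h4 : Nat.card ↥((⟨0, 115, 0, 15625 / 4, 0⟩ : WeierstrassCurve ℚ).sha ⊓
      AddSubgroup.torsionBy (⟨0, 115, 0, 15625 / 4, 0⟩ : WeierstrassCurve ℚ).galH1 2) = 4 := by
    rw [← natCard_torsionBy_addSubgroup, natCard_sha_torsionBy_two_V₀]
  have h2 := natCard_sha_inf_range_V₀
  haveI : Finite ↥((⟨0, 115, 0, 15625 / 4, 0⟩ : WeierstrassCurve ℚ).sha ⊓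
      AddMonoidHom.range (G := Additive (SqUnits ℚ)) (⟨0, 115, 0, 15625 / 4, 0⟩ : WeierstrassCurve ℚ).twoIsogenyTorsorHom) :=
    Nat.finite_of_card_ne_zero (by rw [h2]; norm_num)
  have := Nat.card_le_card_of_injective (AddSubgroup.inclusion hle) (AddSubgroup.inclusion_injective hle)
  omega

/-! ## §3 Parity propagates: `Ш(M₁₀)[φ_{M₁₀}] ≅ ℤ/2` and the class `10 ∈ S(460, 62500)` by global duality -/

/-- **`#(Ш(M₁₀/ℚ) ∩ im Ξ_{M₁₀}) = 2`**: `≥ 2` by `…two_le_natCard_dual_of_shaCorank_two_eq_zero_of_odd` (closed door and ODD defect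
exponent on `V₀`), `≤ 2` by descent. No local point on the corresponding quartic is used. [cite: Cassels1962ArithmeticIV, Thm. 1.1]
[cite: SilvermanAEC2009, Thm. X.4.2(a)] -/
theorem natCard_sha_inf_range_M10_eq_two [hE : (⟨0, -230, 0, -2400, 0⟩ : WeierstrassCurve ℚ).IsElliptic] :
    Nat.card ↥((⟨0, -230, 0, -2400, 0⟩ : WeierstrassCurve ℚ).sha ⊓
        AddMonoidHom.range (G := Additive (SqUnits ℚ)) (⟨0, -230, 0, -2400, 0⟩ : WeierstrassCurve ℚ).twoIsogenyTorsorHom) = 2 := by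
  haveI := isElliptic_V₀
  obtain ⟨h1, h2⟩ := natCard_sha_inf_range_twoIsogenyCodomain_V₀
  haveI : Finite ↥((⟨0, 115, 0, 15625 / 4, 0⟩ : WeierstrassCurve ℚ).twoIsogenyCodomain.sha ⊓
      AddMonoidHom.range (G := Additive (SqUnits ℚ))
        (⟨0, 115, 0, 15625 / 4, 0⟩ : WeierstrassCurve ℚ).twoIsogenyCodomain.twoIsogenyTorsorHom) :=
    Nat.finite_of_card_ne_zero (by omega)
  have hge := two_le_natCard_dual_of_shaCorank_two_eq_zero_of_odd (⟨0, 115, 0, 15625 / 4, 0⟩ : WeierstrassCurve ℚ)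
    shaCorank_V₀_two (d := 1) (by rw [pow_one]; exact natCard_sha_inf_range_V₀) odd_one
  rw [natCard_sha_inf_range_twoIsogenyTorsorHom_congr twoIsogenyCodomain_V₀] at hge h2
  exact le_antisymm h2 hge

/-- **`dim₂ S'(−230, −2400) = dim₂ S(460, 62500) = 1`** (by parity: `2^{dim} = #(Ш(M₁₀) ∩ im Ξ) = 2`). [cite: Cassels1962ArithmeticIV, Thm. 1.1] -/
theorem twoIsogenySelmerRank'_M10_eq_one : twoIsogenySelmerRank' (-230) (-2400) = 1 := by
  haveI := isElliptic_M10
  have h := natCard_sha_inf_range_M10.2.2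
  rw [natCard_sha_inf_range_M10_eq_two] at h
  have h' : 2 ^ twoIsogenySelmerRank' (-230) (-2400) = 2 ^ 1 := by rw [h, pow_one]
  exact Nat.pow_right_injective (le_refl 2) h'

/-- **The class `10` lies in `S(460, 62500)` — an everywhere-local-solubility statement proved by GLOBAL DUALITY**: `S ⊆ {1, 10}`
(descent) and `#S = 2^{dim} = 2` (parity), so `S = {1, 10}`; i.e. `w² = 10u⁴ + 460u²z² + 6250z⁴` has points over `ℝ` and every
`ℚ_p`, with no local point exhibited. [cite: Cassels1962ArithmeticIV, Thm. 1.1] [cite: SilvermanAEC2009, Prop. X.4.9] -/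
theorem mem_twoIsogenySelmerGroup_W_ten : (10 : ℤ) ∈ twoIsogenySelmerGroup 460 62500 := by
  have hcard : (twoIsogenySelmerGroup 460 62500).card = 2 := by
    have h := two_pow_twoIsogenySelmerRank'_eq_card habM10
    rw [twoIsogenySelmerRank'_M10_eq_one, twoIsogenySelmerGroup'_eq,
      show (-2 * (-230) : ℤ) = 460 by norm_num, show ((-230 : ℤ) ^ 2 - 4 * (-2400) : ℤ) = 62500 by norm_num] at h
    omega
  by_contra h10
  have hsub : twoIsogenySelmerGroup 460 62500 ⊆ ({1} : Finset ℤ) := by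
    intro d hd
    have h := twoIsogenySelmerGroup_W_subset hd
    simp only [Finset.mem_insert, Finset.mem_singleton] at h ⊢
    rcases h with rfl | rfl
    · rfl
    · exact absurd hd h10
  have := Finset.card_le_card hsub
  rw [hcard, Finset.card_singleton] at this
  omega

/-- Hence the homogeneous space `w² = 10u⁴ + 460u²z² + 6250z⁴` is everywhere locally soluble (read off the Selmer membership).
[cite: SilvermanAEC2009, Prop. X.4.9] -/
theorem isLocallySoluble_C_ten_W : (twoIsogenyQuartic 460 10 6250).IsLocallySoluble := by
  have h := (mem_twoIsogenySelmerGroup_iff (a := 460) (d := 10) (by norm_num : (62500 : ℤ) ≠ 0)).mp mem_twoIsogenySelmerGroup_W_ten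
  rw [show (62500 : ℤ) / 10 = 6250 by norm_num] at h
  exact h.2.2

/-! ## §4 Reading for T -/

/-- **The hidden-class row**: rank `0`, closed door `t_2(V₀) = 0`, `#Ш(V₀)[φ] = 2` (non-square isogeny defect), `#Ш(V₀/ℚ)[2] = 4` (square,
as `…OddDoor` §4 predicts behind a closed door) — a curve on which neither the door nor the defect is visible to its own `2`-isogeny
descent; both come through the class (`E₀`) and Cassels–Tate. [cite: Cassels1962ArithmeticIV, Thm. 1.1] [cite: SilvermanAEC2009, Thm. X.4.14] -/
theorem hiddenClass_row_V₀ [hV : (⟨0, 115, 0, 15625 / 4, 0⟩ : WeierstrassCurve ℚ).IsElliptic] :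
    (⟨0, 115, 0, 15625 / 4, 0⟩ : WeierstrassCurve ℚ).mordellWeilRank = 0 ∧
      (⟨0, 115, 0, 15625 / 4, 0⟩ : WeierstrassCurve ℚ).shaCorank 2 = 0 ∧
      Nat.card ↥((⟨0, 115, 0, 15625 / 4, 0⟩ : WeierstrassCurve ℚ).sha ⊓
        AddMonoidHom.range (G := Additive (SqUnits ℚ)) (⟨0, 115, 0, 15625 / 4, 0⟩ : WeierstrassCurve ℚ).twoIsogenyTorsorHom) = 2 ∧
      Nat.card ((⟨0, 115, 0, 15625 / 4, 0⟩ : WeierstrassCurve ℚ).sha[(2 : ℤ)]) = 4 :=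
  ⟨mordellWeilRank_V₀, shaCorank_V₀_two, natCard_sha_inf_range_V₀, natCard_sha_torsionBy_two_V₀⟩

end Summit.BirchSwinnertonDyer.BirchSwinnertonDyer.Theorems.ShaPrimaryTransferOddDoor

end
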